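import Literature.MathematicalPhysics.QuantumFieldTheory.Balaban1983to89.B6CubeWindowV1L0
import Literature.MathematicalPhysics.QuantumFieldTheory.Balaban1983to89.B6CubeWindowV1L3
import Literature.MathematicalPhysics.QuantumFieldTheory.Balaban1983to89.B6ScalarChartV1L0
import Literature.MathematicalPhysics.QuantumFieldTheory.Balaban1983to89.B6PadLevelV1
import Literature.MathematicalPhysics.QuantumFieldTheory.Balaban1983to89.B6PadLevelV1L0
/-!
# `Balaban1983to89.B6PadLevelV1L3` — RE-CENTRED-WINDOW TWIN (sub-row G-F3′-L0∕L3 of programme G-F3′-L0; UV3-NODE §26.3 (P2-L3); every odd `L ≥ 3`;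
ruling of record `lit-balaban-r03/G-F3L0-PLAN.md` v1.5 §13 (B′), joints J9′–J11′, J14) of `B6PadLevelV1L0`: the SAME declarations, names and
statements over p21's re-centred root `B6CubeWindowV1L3` (window corner `x0C = S_j·(qc − ℓ) = ctr − (2L−1)S_j/2` — the cube's central block is
the middle block of its `2L`-block member torus, print p.238 «□ in the middle of □̃³ = T_□»; reach sub-window corner `x1C = x0C + (L−2)S_j`;
`PlacedC`; `eC`, `ρ`, `R ≥ 2L²`, `C = 9`, `M_c = 8S/3` UNCHANGED; the binder `(4 ≤ ℓ)` DROPPED).  J14: ONLY the window-dependent declarations are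
re-declared here; every window-free declaration of the L0 twin and every `D`-free object of the lineage is consumed BY NAME.  No existing module is
touched; no fact is minted; standard axioms.  Unit `lit-balaban-p33` (gen 90), 2026-08-27.  THE TWIN'S DOCUMENTATION FOLLOWS VERBATIM (its
«x₀ = ctr − L·S_j/2» / «L ≥ 5» sentences describe the twin; here the anchor is `(2L−1)S_j/2` and L ≥ 3).

statement-level skeleton of published theorems with citation tags; proofs where landed; nothing here is a claim about the Yang–Mills mass gap

# `Balaban1983to89.B6PadLevelV1L0` — LEVEL-0 TWIN (programme G-F3′-L0, director-ym LINE №27 / UV3-NODE §24.5; plan `lit-balaban-r03/G-F3L0-PLAN.md`) of `B6PadLevelV1`: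
the same declarations, SAME NAMES AND STATEMENTS, for nested families WITH print's region `Λ₀ = T ∖ Ω₁` ADMITTED (structures
`B6MultiLevelBoxOperatorL0.Domains` / `B6MultiLevelTorusOperatorL0.TDomains`: levels `0, …, k`, the level-`0` block a single site, `Q′₀ = id`,
finite weight `a₀` — print p.225 (2.14) «Σ_{j=0}^k … (Q′₀λ)(x) = λ(x), x ∈ Λ₀», p.229 «taking a sequence (2.1) … smallest possible domains B^j(Λ_j),
and considering the operator Δ_a defined by (2.19), (2.20) for this sequence»).  Every `D`-free object is the lineage's, consumed BY NAME; no existing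
module is touched; no fact is minted.  Unit `lit-balaban-p33` (p33 gen 89; S-E entry twins named to p33 by the B6 owner r03 gen 36, ruling 2026-08-27T18:45:57Z; port tooling by r03 gen 36); B6 fold owner r03; referee ref-4.  THE TWIN'S DOCUMENTATION FOLLOWS
VERBATIM (its «levels 1 … k» / «Ω₁ = X» sentences describe the twin; here `j` runs from `0` and `Ω₁` may be a proper subset).

# `Balaban1983to89.B6PadLevelV1` — T. Bałaban, *Propagators and renormalization transformations for lattice gauge theories. II*,
# Commun. Math. Phys. **96** (1984) 223–250 [Balaban1984PropagatorsII], (2.1)–(2.4) p. 224 (*"we admit the case when some domains Ω_j are equal to T_η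
# … or are empty"*), (2.19)/(2.22) p. 226, (2.36) p. 229, (2.45)–(2.46) p. 231: LEVEL PADDING — a `k`-level torus family `Ω₁ ⊃ … ⊃ Ω_k` read as a
# `(k+1)`-level family with `Ω_{k+1} = ∅` (top big blocks `L·S_k`, `P′ = L·P″`): the same `Λ_j`, the same index set `𝔅`, THE SAME `Δ_a` AND `G = Δ_a⁻¹`,
# the same blocks, admissible bonds and distance (2.46) — and in the padded family EVERY cube of the cover (2.36) lies below the top level, so r03's
# window construction `…B6CubeWindowV1` places it (`placedC_of_lt`) for EVERY odd `L`

statement-level skeleton of published theorems with citation tags; proofs where landed; nothing here is a claim about the Yang–Mills mass gap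

PDF held: `paper:balaban1984-cmp96-propagators-rt-ii` (journal page = PDF page + 222): p. 224 [PDF 2] ((2.1)–(2.4): *"a sequence of domains
Ω₁ ⊃ Ω₂ ⊃ … ⊃ Ω_k … we admit the case when some domains Ω_j are equal to T_η"*), p. 226 [PDF 4] ((2.19), (2.22)), p. 229 [PDF 7] ((2.36)), p. 231 [PDF 9]
((2.45)–(2.46)); read from the tree transcriptions in `…B6SectADomainsV1`, `…B6SectAVectorModelV1`, `…B6GlobalChartV1`, `…B6Geom246MultiLevelTorus`.

CITATION HEADER (lean-in-tree rule) — WHAT IS REPRODUCED.  Phase-2 file of the `lit-balaban` typed skeleton (HOME `run/shared/lean/pub/lit-balaban/`), seat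
**p38 gen 29** (literature-prover-lit-balaban-p38-g29-0), for the row owner r03's (R6) of B6-CLOSURE §5 item 15 («general-L top-cube placement»); SKELETON
rows **B6.Prop2.6** × B6.Eq2.36 × B6.Eq2.19-2.22 × B6.Eq2.1-2.4 (cells only; decls of record untouched; referee ref-4).  THE POINT.  r03's member window of a
cube of the k-level cover (`…B6CubeWindowV1`) needs the cube PLACED (`PlacedC`: room `L·S_j/2` below its centre in the canonical index-`2` chart) — automatic
below the top level (`placedC_of_lt`), for top cubes only when `L ≤ 5` (`placedC_top`).  Instead of re-running the cube lane in the deeper chart `ccAt`, THIS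
FILE pads the family by one EMPTY level: `padT D : TDomains d ℓ Mh (k+1) P″ R` (same level function, `P′ = L·P″`), for which every cube has level `≤ k <
k + 1` (`placed_pad`), and proves that NOTHING ELSE CHANGES:
* §1 `SameOm D₁ D₂` (two V1 domain data with the same `Ω_j^{(j)}` at every level, ANY numbers of levels): `Λ_j` (sites/bonds), `N(Q′)` agree; the index sets
  `𝔅` are in bijection (`idxB`, level and bond kept); `Q`, `Q*`, `ΔN(Q′)`, **`R`**, **`Δ_a`** (2.19) and **`G = Δ_a⁻¹`** (2.22) AGREE (`QE_eq`, `QsE_UI`,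
  `KE_eq`, `RE_eq`, `deltaAE_eq`, **`GE_eq`**) — the `v = 0`, `k`-free twin of r03's `…B6TranslateV1.IsTr` transport;
* §2 `padT` (the padded torus family), `N0_pad` (`N₀` unchanged), `hN_pad`, `lev_lt_of_mem_cubes_pad`, **`placed_pad`** (every cube of the padded family is
  placed, `P″ ≥ 5`), and **`sameOm_domT_pad`**: r03's V1 domain datum `domT` of the padded family has the same `Ω_j` (level `k + 1` is empty because no site
  has level `k + 1`; `B6ScalarChartV1.exists_iterBlockOf_eq`);
* §3 the block geometry: `bset_pad` (same blocks `𝔅`), the relabelling `eT : 𝔅(D) ≃ 𝔅(padT D)` (identity on labels), `eT_blkV1`, `touchT_pad_iff`, the graph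
  isomorphism `isoT` of the admissible bonds (2.46), hence (graph distance is invariant under isomorphism, a private helper) **`dist_eT`**, `pref_eT`, and the
  transports **`hasMajorant_of_pad`** (a block majorant over the padded family is a block majorant over the family) and `globalBand_pad`.
No `def : Prop`, no new fact; definitions with bodies (`SameOm` — a `Prop`-valued structure, i.e. a hypothesis shape; `SameOm.idxB`, `SameOm.UI`, `padT`,
`eT`, `isoT`); standard axioms.

## HONEST SCOPE / DIVERGENCES

(1) Print allows `Ω_j = T_η` or trivial levels explicitly (p. 224); padding by an empty top level is bookkeeping, not mathematics: the operator `Δ_a` and its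
inverse are LITERALLY unchanged (`GE_eq`).  (2) The padded family has top big blocks `S_{k+1} = L·S_k`, so the torus must consist of `P″_μ = P′_μ/L` of
them: hypothesis `P′ = L·P″` (in the V1 setting `N₀ = 2L^{m+K}` forces `P′ ∈ {2L^n}`, so this is automatic once `P′ ≥ 2L`); `k + 1 ≤ m + K` likewise.
(3) The members `t(□)` built by `…B6CubeWindowV1` for the padded family chart a top cube at `S_k`-index `∈ [2L, 3L)` (room `≥ 2L·S_k ≥ L·S_k/2` below) —
the deeper chart (R6) asked for, obtained for free; below the top level the members are those of `D` verbatim (same chart vectors).  (4) Nothing on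
d = 4 or the continuum; value = the placement hypothesis of the k-level (2.136)₁ made dischargeable for every odd `L ≥ 5` (consumer: `…B6Prop26KLevelAssemblyPadV1`);
NOT summit progress.  Unit `lit-balaban-p38` (gen 29), 2026-08-23.
-/

noncomputable section

open scoped BigOperators InnerProductSpace
open Finset

namespace Literature.MathematicalPhysics.QuantumFieldTheory.Balaban1983to89.B6PadLevelV1L3

open LatticeFieldCalculus
open B5Eq118OneStroke (iterBlockOf)
open Literature.MathematicalPhysics.QuantumFieldTheory.Balaban1983to89.B6PadLevelV1 (SameOm N0_pad hN_pad boxDom_pad)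
open Literature.MathematicalPhysics.QuantumFieldTheory.Balaban1983to89.B6PadLevelV1L0 (padT padT_lev lev_lt_of_mem_cubes_pad sameOm_domT_pad bset_pad eT eT_val eT_blkV1 touchT_pad_iff isoT dist_eT pref_eT hasMajorant_of_pad globalBand_pad)

/-! ## §1 of the original (the `Prop`-structure `SameOm` of two V1 domain data with the same `Ω_j` and its API) concerns V1's
`B6SectADomainsV1.Domains` only — it is `D`-free with respect to the box ∕ torus level structures and is opened BY NAME above, together with the
`D`-free `N0_pad`, `hN_pad`, `boxDom_pad` -/

/-! ## §2  The padded torus family: one more (empty) level, top big blocks `L·S_k`, the same `Ω_j`, every cube placed -/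

section Pad

open B4Reflection242 (boxDom mem_boxDom blk)
open B6MultiLevelBoxOperator (N0 bigSide)
open B6MultiLevelBoxOperatorL0 (Domains)
open B6MultiLevelTorusOperatorL0 (TDomains)
open B6Cover236MultiLevelBlocksL0 (cubes)
open B6GlobalChartV1 (PV toBox)
open B6GlobalChartV1L0 (domT)
open B6ScalarChartV1 (exists_iterBlockOf_eq)
open B6CubeWindowV1L3 (PlacedC placedC_of_lt)

variable {d ℓ Mh k R : ℕ} {P' P'' : Fin (d + 1) → ℕ}

variable {m K : ℕ} {hd : 1 ≤ d + 1} {hL : Odd (ℓ + 1) ∧ 1 < ℓ + 1}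

/-- **EVERY CUBE OF THE PADDED FAMILY IS PLACED** (`P″_μ ≥ 5`): r03's `placedC_of_lt`, the top cubes of `D` being level-`k < k + 1` cubes of `padT D` — their
canonical chart puts them at `S_k`-index `∈ [2L, 3L)`, with room `≥ 2L·S_k` below. [cite: Balaban1984PropagatorsII, p.229 («cubes □ of the size 2ML^jη»), p.238, dictionary (charts)] -/
theorem placed_pad (D : B6MultiLevelTorusOperatorL0.TDomains d ℓ Mh k P' R) (hLP : ∀ μ, P' μ = (ℓ + 1) * P'' μ) (hP5 : ∀ μ, 5 ≤ P'' μ)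
    (c : ↥(cubes (padT D hLP).toDomains)) : PlacedC ℓ (k + 1) P'' c.1 :=
  placedC_of_lt hP5 c.1 (lev_lt_of_mem_cubes_pad D hLP c)

end Pad

/-! ## §3  The block geometry of the padded family: same blocks, same admissible bonds, same distance (2.46) -/

section Geometry

open B4Reflection242 (boxDom mem_boxDom blk)
open B6MultiLevelBoxOperator (N0 bigSide)
open B6MultiLevelBoxOperatorL0 (Domains)
open B6MultiLevelTorusOperatorL0 (TDomains)
open B6Geom246MultiLevelBoxL0 (bset blkOf blkOf_val)
open B6Geom246MultiLevelTorusL0 (geomT bondT TouchT bondT_adj)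
open B6RandomWalk (HasMajorant BlockSupp)
open B6GlobalChartV1 (PV toBox)
open B6GlobalChartV1L0 (domT blkV1)
open B6SectAOperatorsV1 (BondIdx)
open B6Prop26KLevelSkeletonV1L0 (pref)
open B6CubeWindowV1 (GlobalBand)

/-- the level of the image under `SameOm.idxB` (plumbing; the original's private simp lemma `SameOm.idxB_fst`, restated here because a
private declaration is not importable). [folklore] -/
@[simp] private theorem SameOm_idxB_fst {P : Params} {D₁ D₂ : B6SectADomainsV1.Domains P} (h : SameOm D₁ D₂) (i : BondIdx D₂) :
    ((h.idxB i).1.1 : ℕ) = i.1.1 := rfl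

/-- a graph isomorphism does not increase the graph distance (a shortest walk maps to a walk of the same length). [folklore] -/
private theorem dist_iso_le {V W : Type*} {G : SimpleGraph V} {G' : SimpleGraph W} (φ : G ≃g G') (u v : V) : G'.dist (φ u) (φ v) ≤ G.dist u v := by
  by_cases hr : G.Reachable u v
  · obtain ⟨p, hp⟩ := hr.exists_walk_length_eq_dist
    rw [← hp, ← SimpleGraph.Walk.length_map φ.toHom p]
    exact SimpleGraph.dist_le _
  · have hr' : ¬ G'.Reachable (φ u) (φ v) := fun h' => hr (SimpleGraph.Iso.reachable_iff.1 h')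
    rw [SimpleGraph.dist_eq_zero_of_not_reachable hr, SimpleGraph.dist_eq_zero_of_not_reachable hr']

/-- **GRAPH DISTANCE IS INVARIANT UNDER A GRAPH ISOMORPHISM** (both ways). [folklore] -/
private theorem dist_iso {V W : Type*} {G : SimpleGraph V} {G' : SimpleGraph W} (φ : G ≃g G') (u v : V) : G'.dist (φ u) (φ v) = G.dist u v := by
  refine le_antisymm (dist_iso_le φ u v) ?_
  have h2 := dist_iso_le φ.symm (φ u) (φ v)
  rwa [RelIso.symm_apply_apply, RelIso.symm_apply_apply] at h2

variable {d ℓ Mh k R : ℕ} {P' P'' : Fin (d + 1) → ℕ} {m K : ℕ} {hd : 1 ≤ d + 1} {hL : Odd (ℓ + 1) ∧ 1 < ℓ + 1}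
variable (D : TDomains d ℓ Mh k P' R) (hLP : ∀ μ, P' μ = (ℓ + 1) * P'' μ)

end Geometry

end Literature.MathematicalPhysics.QuantumFieldTheory.Balaban1983to89.B6PadLevelV1L3
end
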